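import Summits.AtomisticToContinuum.HydrodynamicLimit.Theses.ImplosionDichotomy

/-!
# The qualitative loophole carried by `ImplosionDichotomy.ImplosionUnboundedDensity`

Helper file for the route support item stmt-AtomisticToContinuum-12590 (`ImplosionUnboundedDensity`,
route `ImplosionDichotomy` of `AtomisticToContinuum/HydrodynamicLimit`). The item's informal gloss —
"no `σ`-uniform `L^∞` density bound holds along the conjunct's solution class" — made formal:
`ImplosionUnboundedDensity` yields continuous positive profiles `(a₀, u₀, θ₀)` for which there are NO
`C` and `σ₀ > 0` such that every admissible classical hard-sphere-Euler solution at every reduced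
diameter `0 < σ < σ₀` (admissible = its `t = 0` fields are the law-of-large-numbers limit of the local
Gibbs laws through every flow family) has density `< C` on its interval of classical existence. This is
the form in which the item speaks to the conjunct `HydrodynamicLimit`, whose `σ₀` depends on the
profiles only: the solution class it quantifies over is not confined to bounded densities.
-/

namespace Summit.AtomisticToContinuum.HydrodynamicLimit.Theorems

open Set
open Literature.MathematicalPhysics.KineticTheory
open Summit.AtomisticToContinuum.HydrodynamicLimit.Theses.ImplosionDichotomy

/-- **No `σ`-uniform density bound along the admissible classical solutions.** If
`ImplosionUnboundedDensity` holds then for its profiles `(a₀, u₀, θ₀)` there are no `C`, `σ₀ > 0` with: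
for all `0 < σ < σ₀`, every classical hard-sphere-Euler solution `(ρ, u, θ)` on `[0, T)` at reduced
diameter `σ` whose `t = 0` fields are the law-of-large-numbers limit of the local Gibbs laws satisfies
`ρ < C` on `[0, T) × 𝕋³`. (Given such `C, σ₀`, the item at level `M := C` supplies `σ₁`; at
`σ := min σ₀ σ₁ / 2` it produces an admissible solution with `C ≤ ρ t x` somewhere, contradicting the
bound.) [folklore] -/
theorem exists_profiles_no_uniform_density_bound (h : ImplosionUnboundedDensity) :
    ∃ (a₀ θ₀ : T3 → ℝ) (u₀ : T3 → V3), Continuous a₀ ∧ Continuous θ₀ ∧ Continuous u₀ ∧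
      (∀ x, 0 < a₀ x) ∧ (∀ x, 0 < θ₀ x) ∧
      ¬ ∃ C σ₀ : ℝ, 0 < σ₀ ∧ ∀ σ : ℝ, 0 < σ → σ < σ₀ →
        ∀ (T : ℝ) (ρ θ : ℝ → T3 → ℝ) (u : ℝ → T3 → V3), IsHardSphereEulerSolution σ T ρ u θ →
          (∀ Φ : (N : ℕ) → Literature.Analysis.FluidPDE.HardSphereFlow
              (Literature.Analysis.FluidPDE.Torus.geometry (Fin 3)) (hsDiameter σ N) (N + 1),
            TendstoHydroFieldsAt (fun N => localGibbsLaw σ a₀ u₀ θ₀ N (Φ N)) Φ ρ u θ 0) →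
          ∀ t ∈ Ico 0 T, ∀ x, ρ t x < C := by
  obtain ⟨a₀, θ₀, u₀, ha, hθ, hu, ha0, hθ0, H⟩ := h
  refine ⟨a₀, θ₀, u₀, ha, hθ, hu, ha0, hθ0, ?_⟩
  rintro ⟨C, σ₀, hσ₀, hb⟩
  obtain ⟨σ₁, hσ₁, H₁⟩ := H C
  have hσpos : 0 < min σ₀ σ₁ / 2 := by positivity
  have hσlt₀ : min σ₀ σ₁ / 2 < σ₀ := by
    have := min_le_left σ₀ σ₁; linarith
  have hσlt₁ : min σ₀ σ₁ / 2 < σ₁ := by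
    have := min_le_right σ₀ σ₁; linarith
  obtain ⟨T, ρ, θ, u, hsol, hadm, t, ht, x, hM⟩ := H₁ (min σ₀ σ₁ / 2) hσpos hσlt₁
  have hlt := hb (min σ₀ σ₁ / 2) hσpos hσlt₀ T ρ θ u hsol hadm t ht x
  linarith

end Summit.AtomisticToContinuum.HydrodynamicLimit.Theorems
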